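import Summits.Langlands.Langlands.Theorems.PhantomRMYoshidaResiduallyYoshidaLiftingSplitFrame
import Summits.Langlands.Langlands.Theorems.PhantomRMYoshidaResiduallyYoshidaLiftingRibetClassUniqueResidual
import Mathlib.NumberTheory.Padics.Complex
import Mathlib.LinearAlgebra.Matrix.Reindex
import HarnessLib

/-!
# The residual class realised by a `ℤ̄_p`-lattice is unique (projectively) — B. Integral frames

Lead prover-line-stmt-Langlands-13639-c2-0 (line `sector-klingen-split`, crux `ResiduallyYoshidaLifting`,
stmt-Langlands-13639), skeleton rev 2.  Companion to Ribet's EXISTENCE theorem `stub_ribetNonsplitLattice`: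
**uniqueness**.  If two `ℤ̄_p`-integral frames of the same `r : Γ → GL₄(ℚ̄_p)` reduce (up to residual conjugators
`h₁, h₂ ∈ GL₄(k)`) to `(σ, B₁; 0, σ')` and `(σ, B₂; 0, σ')` with `B₁`, `B₂` NOT coboundaries, `σ, σ'` irreducible
and non-conjugate, then `B₂ = c • B₁ + (σ X - X σ')` for some `c ∈ kˣ` and `X`: an irreducible (indeed any) `r`
realises AT MOST ONE point of `ℙ H¹(Γ, Hom(σ', σ))` in each orientation.  Together with existence, every
irreducible `Sh`-point `ρ` carries a well-defined invariant `[B_ρ] ∈ ℙ H¹`; the anchor / propagation stubs of the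
line are statements about the fibres of `ρ ↦ [B_ρ]`.

Proof (no irreducibility or continuity of `r` needed): `Q = P₁⁻¹ P₂` intertwines the two frames; rescale it by an
entry of maximal norm to an INTEGRAL `Q₀` with an entry `1` (`exists_integral_rescale`, the value group of `ℚ̄_p`
being all that is used); reduce: `Q̄₀ ≠ 0` intertwines the two reductions; in block form the lower-left block
intertwines `σ → σ'` hence vanishes (Schur + non-conjugacy), the diagonal blocks are scalars `a, d` (Schur over
`k = k̄`), and the upper-right block gives `a B₂ = d B₁ + (σ X - X σ')`; `a, d ≠ 0` because `B₁, B₂` are not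
coboundaries and `Q̄₀ ≠ 0`.
Refs: Ribet 1976 Prop. 2.1; Bellaïche–Chenevier 2009 §1.5 (uniqueness of the non-split end of the lattice
segment over a DVR); here over the non-discrete valuation ring `𝒪(ℚ̄_p)`.
-/

noncomputable section

open scoped MatrixGroups

open Matrix IsLocalRing

-- `Summit.Langlands.Langlands.…` (summit = sub-problem name, D-0017 layout) trips `dupNamespace` on every decl.
set_option linter.dupNamespace false
set_option autoImplicit false

namespace Summit.Langlands.Langlands.Cruxes.ResiduallyYoshidaLifting.SectorKlingenSplit.Ribet

open Summit.Langlands.Langlands.Cruxes.ResiduallyYoshidaLifting.EndoscopicCrossingEuler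
open Literature.NumberTheory.GaloisRepresentations

/-! ### Integral rescaling of an invertible matrix over `ℚ̄_p` -/

section Scaling

variable {p : ℕ} [Fact p.Prime]

/-- **Integral rescaling.**  An invertible matrix `Q` over `ℚ̄_p` is `q • Q₀` with `q ≠ 0`, `Q₀` INTEGRAL and some
entry of `Q₀` equal to `1` (divide by an entry of maximal norm; only the linear order of the value group is used).
[folklore] -/
theorem exists_integral_rescale {ι : Type*} [Fintype ι] [DecidableEq ι] [Nonempty ι] (Q : GL ι (PadicAlgCl p)) :
    ∃ (q : PadicAlgCl p) (Q₀ : Matrix ι ι (Valued.integer (PadicAlgCl p))) (i₀ j₀ : ι), q ≠ 0 ∧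
      Q₀.map (Valued.integer (PadicAlgCl p)).subtype = q⁻¹ • (Q : Matrix ι ι (PadicAlgCl p)) ∧ Q₀ i₀ j₀ = 1 := by
  obtain ⟨⟨i₀, j₀⟩, -, hmax⟩ := Finset.exists_max_image (Finset.univ : Finset (ι × ι))
    (fun ij => ‖(Q : Matrix ι ι (PadicAlgCl p)) ij.1 ij.2‖) Finset.univ_nonempty
  set q : PadicAlgCl p := (Q : Matrix ι ι (PadicAlgCl p)) i₀ j₀ with hq
  have hle : ∀ i j, ‖(Q : Matrix ι ι (PadicAlgCl p)) i j‖ ≤ ‖q‖ := fun i j => hmax ⟨i, j⟩ (Finset.mem_univ _)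
  have hq0 : q ≠ 0 := by
    intro hq0
    have hQ0 : (Q : Matrix ι ι (PadicAlgCl p)) = 0 := by
      ext i j
      have h := hle i j
      rw [hq0, norm_zero] at h
      exact norm_le_zero_iff.mp h
    have h1 : (1 : Matrix ι ι (PadicAlgCl p)) = 0 := by
      rw [← Units.mul_inv Q, hQ0, Matrix.zero_mul]
    obtain ⟨i⟩ := ‹Nonempty ι›
    have h2 : (1 : PadicAlgCl p) = 0 := by simpa using congrFun (congrFun h1 i) i
    exact one_ne_zero h2
  have hmem : ∀ i j, (Q : Matrix ι ι (PadicAlgCl p)) i j / q ∈ Valued.integer (PadicAlgCl p) := by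
    intro i j
    rw [mem_integer_iff_norm_le_one, norm_div]
    exact div_le_one_of_le₀ (hle i j) (norm_nonneg _)
  refine ⟨q, Matrix.of fun i j => ⟨_, hmem i j⟩, i₀, j₀, hq0, ?_, ?_⟩
  · ext i j
    change (Q : Matrix ι ι (PadicAlgCl p)) i j / q = q⁻¹ * (Q : Matrix ι ι (PadicAlgCl p)) i j
    rw [div_eq_inv_mul]
  · exact Subtype.ext (div_self hq0)

end Scaling

/-! ### Uniqueness of the realised class -/

section Unique

variable {p : ℕ} [Fact p.Prime]

/-- **The realised class is projectively unique (core form).**  Two `ℤ̄_p`-integral frames `rint₁, rint₂` of the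
same `r : Γ → GL₄(ℚ̄_p)` (conjugate to `r` by `P₁, P₂`) whose reductions through `red : 𝒪 → k` are
`GL₄(k)`-conjugate to `(σ, B₁; 0, σ')`, `(σ, B₂; 0, σ')` with `B₁, B₂` not coboundaries (`σ, σ'` irreducible and
non-conjugate) realise the same projective class: `B₂ = c • B₁ + (σ X - X σ')`, `c ∈ kˣ`.  No hypothesis on `r`
(not even that it is a homomorphism) and none on `red` is needed. [folklore] -/
theorem realisedClass_unique {k : Type*} [Field k] [IsAlgClosed k] {Γ : Type*} [Group Γ]
    (red : Valued.integer (PadicAlgCl p) →+* k) (σ σ' : Γ →* GL (Fin 2) k)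
    (hσ : Representation.IsIrreducible ((glStdRepresentation (Fin 2) k).comp σ))
    (hσ' : Representation.IsIrreducible ((glStdRepresentation (Fin 2) k).comp σ'))
    (hnc : ¬ ∃ u : GL (Fin 2) k, ∀ x, u * σ x * u⁻¹ = σ' x)
    (r : Γ → GL (Fin 4) (PadicAlgCl p)) (P₁ P₂ : GL (Fin 4) (PadicAlgCl p))
    (rint₁ rint₂ : Γ → GL (Fin 4) (Valued.integer (PadicAlgCl p))) (h₁ h₂ : GL (Fin 4) k)
    (B₁ B₂ : Γ → Matrix (Fin 2) (Fin 2) k)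
    (hP₁ : ∀ g, Matrix.GeneralLinearGroup.map (Valued.integer (PadicAlgCl p)).subtype (rint₁ g) = P₁⁻¹ * r g * P₁)
    (hred₁ : ∀ g, (Matrix.GeneralLinearGroup.map red (rint₁ g)).val =
      h₁.val * Matrix.reindex finSumFinEquiv finSumFinEquiv
        (Matrix.fromBlocks (σ g).val (B₁ g) 0 (σ' g).val) * (h₁⁻¹).val)
    (hP₂ : ∀ g, Matrix.GeneralLinearGroup.map (Valued.integer (PadicAlgCl p)).subtype (rint₂ g) = P₂⁻¹ * r g * P₂)
    (hred₂ : ∀ g, (Matrix.GeneralLinearGroup.map red (rint₂ g)).val =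
      h₂.val * Matrix.reindex finSumFinEquiv finSumFinEquiv
        (Matrix.fromBlocks (σ g).val (B₂ g) 0 (σ' g).val) * (h₂⁻¹).val)
    (hB₁ : ¬ ∃ X : Matrix (Fin 2) (Fin 2) k, ∀ g, B₁ g = (σ g).val * X - X * (σ' g).val)
    (hB₂ : ¬ ∃ X : Matrix (Fin 2) (Fin 2) k, ∀ g, B₂ g = (σ g).val * X - X * (σ' g).val) :
    ∃ (c : kˣ) (X : Matrix (Fin 2) (Fin 2) k), ∀ g, B₂ g = (c : k) • B₁ g + ((σ g).val * X - X * (σ' g).val) := by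
  -- the intertwiner `Q = P₁⁻¹ P₂` over `ℚ̄_p`
  have hQ : ∀ g, Matrix.GeneralLinearGroup.map (Valued.integer (PadicAlgCl p)).subtype (rint₁ g) * (P₁⁻¹ * P₂) =
      (P₁⁻¹ * P₂) * Matrix.GeneralLinearGroup.map (Valued.integer (PadicAlgCl p)).subtype (rint₂ g) := by
    intro g
    rw [hP₁, hP₂]
    group
  -- integral rescaling
  obtain ⟨q, Q₀, i₀, j₀, -, hQ₀, hone⟩ := exists_integral_rescale (P₁⁻¹ * P₂)
  have hQv : ∀ g, ((rint₁ g : GL (Fin 4) (Valued.integer (PadicAlgCl p))) :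
        Matrix (Fin 4) (Fin 4) (Valued.integer (PadicAlgCl p))).map (Valued.integer (PadicAlgCl p)).subtype *
        ((P₁⁻¹ * P₂ : GL (Fin 4) (PadicAlgCl p)) : Matrix (Fin 4) (Fin 4) (PadicAlgCl p)) =
      ((P₁⁻¹ * P₂ : GL (Fin 4) (PadicAlgCl p)) : Matrix (Fin 4) (Fin 4) (PadicAlgCl p)) *
        ((rint₂ g : GL (Fin 4) (Valued.integer (PadicAlgCl p))) :
          Matrix (Fin 4) (Fin 4) (Valued.integer (PadicAlgCl p))).map (Valued.integer (PadicAlgCl p)).subtype := by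
    intro g
    have h := congrArg (fun u : GL (Fin 4) (PadicAlgCl p) => (u : Matrix (Fin 4) (Fin 4) (PadicAlgCl p))) (hQ g)
    simp only [Units.val_mul] at h
    exact h
  have hint : ∀ g, ((rint₁ g : GL (Fin 4) (Valued.integer (PadicAlgCl p))) :
        Matrix (Fin 4) (Fin 4) (Valued.integer (PadicAlgCl p))) * Q₀ =
      Q₀ * ((rint₂ g : GL (Fin 4) (Valued.integer (PadicAlgCl p))) :
        Matrix (Fin 4) (Fin 4) (Valued.integer (PadicAlgCl p))) := by
    intro g
    have h : (((rint₁ g : GL (Fin 4) (Valued.integer (PadicAlgCl p))) :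
          Matrix (Fin 4) (Fin 4) (Valued.integer (PadicAlgCl p))) * Q₀).map (Valued.integer (PadicAlgCl p)).subtype =
        (Q₀ * ((rint₂ g : GL (Fin 4) (Valued.integer (PadicAlgCl p))) :
          Matrix (Fin 4) (Fin 4) (Valued.integer (PadicAlgCl p)))).map (Valued.integer (PadicAlgCl p)).subtype := by
      rw [Matrix.map_mul, Matrix.map_mul, hQ₀, Matrix.mul_smul, Matrix.smul_mul, hQv g]
    exact Matrix.map_injective (f := ⇑(Valued.integer (PadicAlgCl p)).subtype) Subtype.val_injective h
  -- reduce: `Q̄₀ ≠ 0` intertwines the two reductions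
  have hQb0 : Q₀.map red ≠ 0 := by
    intro h0
    have h := congrFun (congrFun h0 i₀) j₀
    rw [Matrix.map_apply, hone, map_one] at h
    exact one_ne_zero h
  have hredint : ∀ g,
      (h₁.val * Matrix.reindex finSumFinEquiv finSumFinEquiv (Matrix.fromBlocks (σ g).val (B₁ g) 0 (σ' g).val) *
        (h₁⁻¹).val) * Q₀.map red =
      Q₀.map red * (h₂.val * Matrix.reindex finSumFinEquiv finSumFinEquiv
        (Matrix.fromBlocks (σ g).val (B₂ g) 0 (σ' g).val) * (h₂⁻¹).val) := by
    intro g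
    have h := congrArg (fun M : Matrix (Fin 4) (Fin 4) (Valued.integer (PadicAlgCl p)) => M.map red) (hint g)
    simp only [Matrix.map_mul] at h
    rw [← hred₁ g, ← hred₂ g]
    exact h
  -- the residual intertwiner `M = h₁⁻¹ Q̄₀ h₂` between the two block forms
  have hM : ∀ g, Matrix.reindex finSumFinEquiv finSumFinEquiv (Matrix.fromBlocks (σ g).val (B₁ g) 0 (σ' g).val) *
        ((h₁⁻¹).val * Q₀.map red * h₂.val) =
      ((h₁⁻¹).val * Q₀.map red * h₂.val) *
        Matrix.reindex finSumFinEquiv finSumFinEquiv (Matrix.fromBlocks (σ g).val (B₂ g) 0 (σ' g).val) := by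
    intro g
    have e1 : Matrix.reindex finSumFinEquiv finSumFinEquiv (Matrix.fromBlocks (σ g).val (B₁ g) 0 (σ' g).val) *
        ((h₁⁻¹).val * Q₀.map red * h₂.val) =
        (h₁⁻¹).val * ((h₁.val * Matrix.reindex finSumFinEquiv finSumFinEquiv
          (Matrix.fromBlocks (σ g).val (B₁ g) 0 (σ' g).val) * (h₁⁻¹).val) * Q₀.map red) * h₂.val := by
      simp only [Matrix.mul_assoc, Units.inv_mul_cancel_left]
    have e2 : ((h₁⁻¹).val * Q₀.map red * h₂.val) *
        Matrix.reindex finSumFinEquiv finSumFinEquiv (Matrix.fromBlocks (σ g).val (B₂ g) 0 (σ' g).val) =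
        (h₁⁻¹).val * (Q₀.map red * (h₂.val * Matrix.reindex finSumFinEquiv finSumFinEquiv
          (Matrix.fromBlocks (σ g).val (B₂ g) 0 (σ' g).val) * (h₂⁻¹).val)) * h₂.val := by
      simp only [Matrix.mul_assoc, Units.inv_mul, Matrix.mul_one]
    rw [e1, hredint g, ← e2]
  have hM0 : (h₁⁻¹).val * Q₀.map red * h₂.val ≠ 0 := by
    intro h0
    apply hQb0
    have h : Q₀.map red = h₁.val * ((h₁⁻¹).val * Q₀.map red * h₂.val) * (h₂⁻¹).val := by
      simp only [Matrix.mul_assoc, Units.mul_inv_cancel_left, Units.mul_inv, Matrix.mul_one]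
    rw [h, h0, Matrix.mul_zero, Matrix.zero_mul]
  -- block coordinates
  have hsub : ∀ X : Matrix (Fin 2 ⊕ Fin 2) (Fin 2 ⊕ Fin 2) k,
      (Matrix.reindex finSumFinEquiv finSumFinEquiv X).submatrix finSumFinEquiv finSumFinEquiv = X := fun X => by
    rw [Matrix.reindex_apply, Matrix.submatrix_submatrix, Equiv.symm_comp_self, Matrix.submatrix_id_id]
  have hsm : ∀ A C : Matrix (Fin 4) (Fin 4) k,
      (A * C).submatrix ⇑(finSumFinEquiv : Fin 2 ⊕ Fin 2 ≃ Fin (2 + 2)) ⇑(finSumFinEquiv : Fin 2 ⊕ Fin 2 ≃ Fin (2 + 2)) =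
        A.submatrix ⇑(finSumFinEquiv : Fin 2 ⊕ Fin 2 ≃ Fin (2 + 2)) ⇑(finSumFinEquiv : Fin 2 ⊕ Fin 2 ≃ Fin (2 + 2)) *
          C.submatrix ⇑(finSumFinEquiv : Fin 2 ⊕ Fin 2 ≃ Fin (2 + 2)) ⇑(finSumFinEquiv : Fin 2 ⊕ Fin 2 ≃ Fin (2 + 2)) :=
    fun A C => (Matrix.submatrix_mul_equiv A C _ (finSumFinEquiv : Fin 2 ⊕ Fin 2 ≃ Fin (2 + 2)) _).symm
  have hN : ∀ g, Matrix.fromBlocks (σ g).val (B₁ g) 0 (σ' g).val *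
        ((h₁⁻¹).val * Q₀.map red * h₂.val).submatrix ⇑(finSumFinEquiv : Fin 2 ⊕ Fin 2 ≃ Fin (2 + 2))
          ⇑(finSumFinEquiv : Fin 2 ⊕ Fin 2 ≃ Fin (2 + 2)) =
      ((h₁⁻¹).val * Q₀.map red * h₂.val).submatrix ⇑(finSumFinEquiv : Fin 2 ⊕ Fin 2 ≃ Fin (2 + 2))
          ⇑(finSumFinEquiv : Fin 2 ⊕ Fin 2 ≃ Fin (2 + 2)) *
        Matrix.fromBlocks (σ g).val (B₂ g) 0 (σ' g).val := by
    intro g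
    have h := congrArg (fun X : Matrix (Fin 4) (Fin 4) k =>
      X.submatrix ⇑(finSumFinEquiv : Fin 2 ⊕ Fin 2 ≃ Fin (2 + 2)) ⇑(finSumFinEquiv : Fin 2 ⊕ Fin 2 ≃ Fin (2 + 2))) (hM g)
    rw [hsm (Matrix.reindex finSumFinEquiv finSumFinEquiv (Matrix.fromBlocks (σ g).val (B₁ g) 0 (σ' g).val))
        ((h₁⁻¹).val * Q₀.map red * h₂.val),
      hsm ((h₁⁻¹).val * Q₀.map red * h₂.val)
        (Matrix.reindex finSumFinEquiv finSumFinEquiv (Matrix.fromBlocks (σ g).val (B₂ g) 0 (σ' g).val)),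
      hsub, hsub] at h
    exact h
  have hN0 : ((h₁⁻¹).val * Q₀.map red * h₂.val).submatrix ⇑(finSumFinEquiv : Fin 2 ⊕ Fin 2 ≃ Fin (2 + 2))
      ⇑(finSumFinEquiv : Fin 2 ⊕ Fin 2 ≃ Fin (2 + 2)) ≠ 0 := by
    intro h0
    apply hM0
    have h : (h₁⁻¹).val * Q₀.map red * h₂.val = Matrix.reindex finSumFinEquiv finSumFinEquiv
        (((h₁⁻¹).val * Q₀.map red * h₂.val).submatrix ⇑(finSumFinEquiv : Fin 2 ⊕ Fin 2 ≃ Fin (2 + 2))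
          ⇑(finSumFinEquiv : Fin 2 ⊕ Fin 2 ≃ Fin (2 + 2))) := by
      rw [Matrix.reindex_apply, Matrix.submatrix_submatrix, Equiv.self_comp_symm, Matrix.submatrix_id_id]
    rw [h, h0, Matrix.reindex_apply, Matrix.submatrix_zero]
    rfl
  exact class_unique_of_intertwiner σ σ' hσ hσ' hnc B₁ B₂ hB₁ hB₂ _ hN0 hN

/-- **Registered statement `stub_realisedClassUnique`** (crux stmt-Langlands-13639, line `sector-klingen-split`,
skeleton rev 2; the uniqueness companion of `stub_ribetNonsplitLattice`, in its vocabulary): two integral frames of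
the same framed Galois representation `r : Γ_ℚ → GL₄(ℚ̄_p)` with non-split reductions `(σ, Bᵢ; 0, σ')` realise the
same projective class — `B₂ = c • B₁ + (σ X - X σ')`, `c ∈ kˣ`. [folklore] -/
theorem stub_realisedClassUnique :
    ∀ (p : ℕ) [Fact p.Prime] (k : Type) [Field k] [IsAlgClosed k] [TopologicalSpace k] [DiscreteTopology k]
      (red : Valued.integer (PadicAlgCl p) →+* k)
      (σ σ' : Literature.NumberTheory.GaloisRepresentations.FramedGaloisRep ℚ k 2)
      (r : Literature.NumberTheory.GaloisRepresentations.FramedGaloisRep ℚ (PadicAlgCl p) 4),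
      σ.toGaloisRep.IsIrreducible → σ'.toGaloisRep.IsIrreducible →
      (¬ ∃ g : GL (Fin 2) k, ∀ x, g * σ x * g⁻¹ = σ' x) →
      ∀ (P₁ P₂ : GL (Fin 4) (PadicAlgCl p))
        (rint₁ rint₂ : Field.absoluteGaloisGroup ℚ →* GL (Fin 4) (Valued.integer (PadicAlgCl p)))
        (h₁ h₂ : GL (Fin 4) k) (B₁ B₂ : Field.absoluteGaloisGroup ℚ → Matrix (Fin 2) (Fin 2) k),
      (∀ g, Matrix.GeneralLinearGroup.map (Valued.integer (PadicAlgCl p)).subtype (rint₁ g) = P₁⁻¹ * r g * P₁) →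
      (∀ g, (Matrix.GeneralLinearGroup.map red (rint₁ g)).val =
        h₁.val * Matrix.reindex finSumFinEquiv finSumFinEquiv
          (Matrix.fromBlocks (σ g).val (B₁ g) 0 (σ' g).val) * (h₁⁻¹).val) →
      (∀ g, Matrix.GeneralLinearGroup.map (Valued.integer (PadicAlgCl p)).subtype (rint₂ g) = P₂⁻¹ * r g * P₂) →
      (∀ g, (Matrix.GeneralLinearGroup.map red (rint₂ g)).val =
        h₂.val * Matrix.reindex finSumFinEquiv finSumFinEquiv
          (Matrix.fromBlocks (σ g).val (B₂ g) 0 (σ' g).val) * (h₂⁻¹).val) →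
      (¬ ∃ X : Matrix (Fin 2) (Fin 2) k, ∀ g, B₁ g = (σ g).val * X - X * (σ' g).val) →
      (¬ ∃ X : Matrix (Fin 2) (Fin 2) k, ∀ g, B₂ g = (σ g).val * X - X * (σ' g).val) →
      ∃ (c : kˣ) (X : Matrix (Fin 2) (Fin 2) k), ∀ g, B₂ g = (c : k) • B₁ g + ((σ g).val * X - X * (σ' g).val) := by
  intro p _ k _ _ _ _ red σ σ' r hσ hσ' hnc P₁ P₂ rint₁ rint₂ h₁ h₂ B₁ B₂ hP₁ hred₁ hP₂ hred₂ hB₁ hB₂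
  have hσm : Representation.IsIrreducible ((glStdRepresentation (Fin 2) k).comp σ.toMonoidHom) := hσ
  have hσ'm : Representation.IsIrreducible ((glStdRepresentation (Fin 2) k).comp σ'.toMonoidHom) := hσ'
  exact realisedClass_unique red σ.toMonoidHom σ'.toMonoidHom hσm hσ'm hnc (fun g => r g) P₁ P₂
    (fun g => rint₁ g) (fun g => rint₂ g) h₁ h₂ B₁ B₂ hP₁ hred₁ hP₂ hred₂ hB₁ hB₂

end Unique

end Summit.Langlands.Langlands.Cruxes.ResiduallyYoshidaLifting.SectorKlingenSplit.Ribet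

end
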